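import Summits.ResolutionOfSingularities.ResolutionOfSingularities.Theorems.EquisingularLiftEquisingularLiftNatNoseHostedHSUB
import Summits.ResolutionOfSingularities.ResolutionOfSingularities.Theorems.EquisingularLiftEquisingularLiftNatResidueHypDefsE2
import HarnessLib

/-!
# EL♮(3), door ν4 «EQUINODAL PLANAR NOSE»: HSUBᵉ COMPOSED FROM AN INNER UPSTAIRS MOTIVE AND ITS SUPPLIERS (nose round + B‴ tail PROVED)

res-L1-w45b-nose-w1 g3 (WIDTH seat D-0157 DOOR 1; HSUBᵉ pen, desk R58 (2)).  The upstairs debt HSUBᵉ of the K5ᵉ engine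
(`target_elnat_of_hostedSubchainResolutionₑ`, ✓ p674976) asks, for every move of the door `ReachEquinodalPlanarNose₂ k 3 ℓ T₁ F₉ β T₉ E₉`
(…NatResidueHypDefsE2, ✓ p674326), a new upstairs stage in HSUBʰ's currency.  This file proves the COMPOSITION once and for all, for an
ARBITRARY inner upstairs motive `RD G γ T E W` (a parameter — stub-2's NU4-SIZING §E E.1 `R⁺` is the intended instance) given four suppliers:

* `JINIT` — `RD` holds at the door's initial stage `(ℙ³_k, 𝟙, T₁, V₊(ℓ), Z)` from the door's STATIC data (all ten clauses + `EqCertAt₀`) [brick N-0];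
* `HNODE` — `RD` is closed under the door's (pt) clause (binder list VERBATIM) [brick N-PT];
* `HRDZ`  — `RD` is closed under the door's (rd) clause (binder list VERBATIM) [brick N-RD];
* `HEND`  — at the reached stage, `RD F₂ υ T₂ E₂ Z₂` + `Z₂ ⊆ T₂` + `Z̃₂` regular deliver an upstairs stage `(X', σ', S', j, t)` in the chain
  TOGETHER WITH a regular `O`-flat model `C` of `Z₂` with reduced trace `C.comap j = 𝓘⟨Z₂⟩` [the m = 0 exit of the nose datum].

Given these, PHASE 1 is one application of the door's universal motive clause to `RD`, and PHASE 2 — the nose round on the GIVEN centre `C`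
(E1-legality off the generic point of `Y` from the chain, …NatCentreOffGeneric; the model square `modelStep_chain`; the stage-generic nose
engine‴ `hsub_reachNoseTowerBTriplePrime_of_fact'` on the B‴ tail, fed with (T-k) = `EmbeddedCurveLiftFact`; the host dropped, `E₉ = ∅`,
`TCPlus.letterDatum_empty`) — is res-L1-w45b-nose-w2's …NatNoseHostedHSUB proof pattern, here with NO (T-k) call for the nose centre itself
(upstairs the centre is the given strict transform, as the door's design note demands).

Conditional on (T-k) through the tail exactly like (R-ν3); no new mathematics; counted 0.  EL♮(3) is NOT proved here; resolution of
singularities in positive characteristic is NOT proved anywhere in this tree.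
-/

set_option linter.dupNamespace false
set_option linter.overlappingInstances false

noncomputable section

open CategoryTheory CategoryTheory.Limits AlgebraicGeometry TopologicalSpace Topology IsLocalRing
open Literature.AlgebraicGeometry.Resolution
open AlgebraicGeometry.Scheme.IdealSheafData
open Summit.ResolutionOfSingularities.ResolutionOfSingularities.Theses.EquisingularLift.Split
open Summit.ResolutionOfSingularities.ResolutionOfSingularities.Cruxes.EquisingularLift.StrataSplit

namespace Summit.ResolutionOfSingularities.ResolutionOfSingularities.Cruxes.EquisingularLiftNat.Sections.Equinodal

/-- **HSUBᵉ FROM SUPPLIERS (composition; the nose round on the given centre and the B‴ tail are proved).**  For ANY inner upstairs motive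
`RD` over `ℙ³_k` carrying `(T, E, W)` with `JINIT` (it holds at the door's initial stage from the door's static data and `EqCertAt₀`),
`HNODE` / `HRDZ` (it is closed under `ReachEquinodalPlanarNose₂`'s inner (pt) / (rd) clauses, binder lists VERBATIM) and `HEND` (at the reached
stage it delivers an upstairs stage in the chain WITH a regular `O`-flat model `C` of `Z₂` with reduced trace), every move
`ReachEquinodalPlanarNose₂ k 3 ℓ T₁ F₉ β T₉ E₉` is matched by a new upstairs stage in HSUBʰ's currency (host dropped: `E₉ = ∅`, trivial letter).
Conditional on (T-k) (`EmbeddedCurveLiftFact`) through the B‴ tail, like (R-ν3).  EL♮(3) NOT proved; char-p resolution NOT proved.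
[OURS · L1 W4.5b · door ν4 · HSUBᵉ composition, counted 0] -/
theorem hsube_of_suppliers (hF : EmbeddedCurveLiftFact) (k : Type) [Field k] [IsAlgClosed k]
    (O : Type) [CommRing O] [IsDomain O] [IsDiscreteValuationRing O] [IsAdicComplete (IsLocalRing.maximalIdeal O) O]
    [IsAlgClosed (IsLocalRing.ResidueField O)] (θ : O →+* k) (hθ : Function.Surjective θ)
    (P : Scheme.{0}) (q : P ⟶ Spec (.of O)) (Y : Set P) (Ch : ∀ X' : Scheme.{0}, (X' ⟶ P) → Set X' → Prop)
    (hChStep : ∀ (X' X'' : Scheme.{0}) (σ' : X' ⟶ P) (S' : Set X') (C : X'.IdealSheafData) (τ : X'' ⟶ X'),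
      Ch X' σ' S' → IsBlowup τ C → Scheme.IsRegular C.subscheme → Flat (C.subschemeι ≫ σ' ≫ q) →
      σ' '' (C.support : Set X') ⊆ {y | ¬ IsGenericPoint y Y} → (C.support : Set X') ∩ (σ' ≫ q) ⁻¹' {IsLocalRing.closedPoint O} ⊆ S' →
      Ch X'' (τ ≫ σ') (closure (τ ⁻¹' (S' \ (C.support : Set X')))))
    (hChSplit : ∀ (X' : Scheme.{0}) (σ' : X' ⟶ P) (S' : Set X'), Ch X' σ' S' → Chain P Y X' σ' S')
    (hYsp : Y ⊆ q ⁻¹' {IsLocalRing.closedPoint O}) (hYirr : IsIrreducible Y) (hYcl : IsClosed Y) (hPint : IsIntegral P)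
    (hPnoeth : IsLocallyNoetherian P) (hPreg : Scheme.IsRegular P) (hqprop : IsProper q) (hqsm : SmoothOfRelativeDimension 3 q)
    -- the door's parameters, the inner upstairs motive and its four suppliers
    (ℓ : MvPolynomial (Fin (3 + 1)) k) (T₁ : Set (Literature.AlgebraicGeometry.Motives.projectiveSpace 3 k).left)
    (RD : ∀ G : Scheme.{0}, (G ⟶ (Literature.AlgebraicGeometry.Motives.projectiveSpace 3 k).left) → Set G → Set G → Set G → Prop)
    (JINIT : letI := MvPolynomial.gradedAlgebra (σ := Fin (3 + 1)) (R := k)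
      ∀ (Z : Set (Literature.AlgebraicGeometry.Motives.projectiveSpace 3 k).left) (hZ : IsClosed Z),
        Z ⊆ T₁ →
        ¬ (T₁ ⊆ Z) →
        Z.Infinite →
        Z ⊆ {y : (Literature.AlgebraicGeometry.Motives.projectiveSpace 3 k).left | ℓ ∈ (y : ProjectiveSpectrum (MvPolynomial.homogeneousSubmodule (Fin (3 + 1)) k)).asHomogeneousIdeal} →
        IsPreirreducible Z →
        (∀ z : ↥(redSub (Literature.AlgebraicGeometry.Motives.projectiveSpace 3 k).left Z hZ), IsClosed ({z} : Set ↥(redSub (Literature.AlgebraicGeometry.Motives.projectiveSpace 3 k).left Z hZ)) →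
              ringKrullDim ((redSub (Literature.AlgebraicGeometry.Motives.projectiveSpace 3 k).left Z hZ).presheaf.stalk z) = ((1 : ℕ) : WithBot ℕ∞)) →
        (∀ (i : redSub (Literature.AlgebraicGeometry.Motives.projectiveSpace 3 k).left Z hZ ⟶ redSub (Literature.AlgebraicGeometry.Motives.projectiveSpace 3 k).left Set.univ isClosed_univ), i ≫ redSubι (Literature.AlgebraicGeometry.Motives.projectiveSpace 3 k).left Set.univ isClosed_univ = redSubι (Literature.AlgebraicGeometry.Motives.projectiveSpace 3 k).left Z hZ →
              ∀ z : ↥(redSub (Literature.AlgebraicGeometry.Motives.projectiveSpace 3 k).left Z hZ), IsRegularLocalRing ((redSub (Literature.AlgebraicGeometry.Motives.projectiveSpace 3 k).left Set.univ isClosed_univ).presheaf.stalk (i.base z))) →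
        (∀ (i : redSub (Literature.AlgebraicGeometry.Motives.projectiveSpace 3 k).left Z hZ ⟶ redSub (Literature.AlgebraicGeometry.Motives.projectiveSpace 3 k).left (closure {y : (Literature.AlgebraicGeometry.Motives.projectiveSpace 3 k).left | ℓ ∈ (y : ProjectiveSpectrum (MvPolynomial.homogeneousSubmodule (Fin (3 + 1)) k)).asHomogeneousIdeal}) isClosed_closure),
              i ≫ redSubι (Literature.AlgebraicGeometry.Motives.projectiveSpace 3 k).left (closure {y : (Literature.AlgebraicGeometry.Motives.projectiveSpace 3 k).left | ℓ ∈ (y : ProjectiveSpectrum (MvPolynomial.homogeneousSubmodule (Fin (3 + 1)) k)).asHomogeneousIdeal}) isClosed_closure = redSubι (Literature.AlgebraicGeometry.Motives.projectiveSpace 3 k).left Z hZ →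
              ∀ z : ↥(redSub (Literature.AlgebraicGeometry.Motives.projectiveSpace 3 k).left Z hZ), IsRegularLocalRing ((redSub (Literature.AlgebraicGeometry.Motives.projectiveSpace 3 k).left (closure {y : (Literature.AlgebraicGeometry.Motives.projectiveSpace 3 k).left | ℓ ∈ (y : ProjectiveSpectrum (MvPolynomial.homogeneousSubmodule (Fin (3 + 1)) k)).asHomogeneousIdeal}) isClosed_closure).presheaf.stalk (i.base z))) →
        (∀ e : ↥(redSub (Literature.AlgebraicGeometry.Motives.projectiveSpace 3 k).left (closure {y : (Literature.AlgebraicGeometry.Motives.projectiveSpace 3 k).left | ℓ ∈ (y : ProjectiveSpectrum (MvPolynomial.homogeneousSubmodule (Fin (3 + 1)) k)).asHomogeneousIdeal}) isClosed_closure),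
              IsClosed ({e} : Set ↥(redSub (Literature.AlgebraicGeometry.Motives.projectiveSpace 3 k).left (closure {y : (Literature.AlgebraicGeometry.Motives.projectiveSpace 3 k).left | ℓ ∈ (y : ProjectiveSpectrum (MvPolynomial.homogeneousSubmodule (Fin (3 + 1)) k)).asHomogeneousIdeal}) isClosed_closure)) →
              (redSubι (Literature.AlgebraicGeometry.Motives.projectiveSpace 3 k).left (closure {y : (Literature.AlgebraicGeometry.Motives.projectiveSpace 3 k).left | ℓ ∈ (y : ProjectiveSpectrum (MvPolynomial.homogeneousSubmodule (Fin (3 + 1)) k)).asHomogeneousIdeal}) isClosed_closure e : (Literature.AlgebraicGeometry.Motives.projectiveSpace 3 k).left) ∈ Z →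
              ringKrullDim ((redSub (Literature.AlgebraicGeometry.Motives.projectiveSpace 3 k).left (closure {y : (Literature.AlgebraicGeometry.Motives.projectiveSpace 3 k).left | ℓ ∈ (y : ProjectiveSpectrum (MvPolynomial.homogeneousSubmodule (Fin (3 + 1)) k)).asHomogeneousIdeal}) isClosed_closure).presheaf.stalk e) = ((2 : ℕ) : WithBot ℕ∞)) →
        EqCertAt₀ k 3 ℓ Z hZ →
        RD (Literature.AlgebraicGeometry.Motives.projectiveSpace 3 k).left (𝟙 (Literature.AlgebraicGeometry.Motives.projectiveSpace 3 k).left) T₁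
          {y : (Literature.AlgebraicGeometry.Motives.projectiveSpace 3 k).left | ℓ ∈ (y : ProjectiveSpectrum (MvPolynomial.homogeneousSubmodule (Fin (3 + 1)) k)).asHomogeneousIdeal} Z)
    (HNODE :
        (∀ (G G' : Scheme.{0}) (γ : G ⟶ (Literature.AlgebraicGeometry.Motives.projectiveSpace 3 k).left) (T E W : Set G) (hW : IsClosed W) (w : ↥(redSub G W hW)) (υ₁ : G' ⟶ G)
            (hy : IsClosed ({(redSubι G W hW w : G)} : Set G)),
          RD G γ T E W → W ⊆ T → ¬ IsRegularLocalRing ((redSub G W hW).presheaf.stalk w) →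
          IsRegularLocalRing (G.presheaf.stalk (redSubι G W hW w : G)) →
          ((redSubι G W hW w : G) ∈ closure E → ∀ e : ↥(redSub G (closure E) isClosed_closure),
            (redSubι G (closure E) isClosed_closure e : G) = (redSubι G W hW w : G) →
            IsRegularLocalRing ((redSub G (closure E) isClosed_closure).presheaf.stalk e)) →
          IsBlowup υ₁ (vanishingIdeal (⟨{(redSubι G W hW w : G)}, hy⟩ : Closeds G)) →
          RD G' (υ₁ ≫ γ) (closure (υ₁ ⁻¹' (T \ {(redSubι G W hW w : G)}))) (closure (υ₁ ⁻¹' (E \ {(redSubι G W hW w : G)})))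
            (closure (υ₁ ⁻¹' (W \ {(redSubι G W hW w : G)})))))
    (HRDZ :
        (∀ (G G' : Scheme.{0}) (γ : G ⟶ (Literature.AlgebraicGeometry.Motives.projectiveSpace 3 k).left) (T E W : Set G) (Z' : Set G) (hZ' : IsClosed Z') (υ' : G' ⟶ G),
          RD G γ T E W → W ⊆ T → ¬ W ⊆ Z' → Z' ⊆ closure E → Z' ⊆ T → ¬ T ⊆ Z' → (∀ z : ↥(redSub G Z' hZ'), IsRegularLocalRing ((redSub G Z' hZ').presheaf.stalk z)) →
          (∀ (i : redSub G Z' hZ' ⟶ redSub G (closure E) isClosed_closure), i ≫ redSubι G (closure E) isClosed_closure = redSubι G Z' hZ' →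
            ∀ z : ↥(redSub G Z' hZ'), IsRegularLocalRing ((redSub G (closure E) isClosed_closure).presheaf.stalk (i z))) → DirStepUnobs G (closure E) isClosed_closure Z' hZ' →
          (∀ z : ↥(redSub G Z' hZ'), IsClosed ({z} : Set ↥(redSub G Z' hZ')) → ringKrullDim ((redSub G Z' hZ').presheaf.stalk z) = ((1 : ℕ) : WithBot ℕ∞)) →
          IsBlowup υ' (vanishingIdeal (⟨Z', hZ'⟩ : Closeds G)) →
          RD G' (υ' ≫ γ) (closure (υ' ⁻¹' (T \ Z'))) (closure (υ' ⁻¹' (closure E \ Z'))) (closure (υ' ⁻¹' (W \ Z')))))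
    (HEND : ∀ (F₂ : Scheme.{0}) (υ : F₂ ⟶ (Literature.AlgebraicGeometry.Motives.projectiveSpace 3 k).left) (T₂ E₂ Z₂ : Set F₂) (hZ₂ : IsClosed Z₂),
      RD F₂ υ T₂ E₂ Z₂ → Z₂ ⊆ T₂ → (∀ z : ↥(redSub F₂ Z₂ hZ₂), IsRegularLocalRing ((redSub F₂ Z₂ hZ₂).presheaf.stalk z)) →
      ∃ (X' : Scheme.{0}) (σ' : X' ⟶ P) (S' : Set X') (j : F₂ ⟶ X') (t : F₂ ⟶ Spec (.of k)) (C : X'.IdealSheafData),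
        Ch X' σ' S' ∧ IsIntegral X' ∧ IsLocallyNoetherian X' ∧ Scheme.IsRegular X' ∧ IsDominant (σ' ≫ q) ∧ IsIntegral F₂ ∧
        IsPullback j t (σ' ≫ q) (Spec.map (CommRingCat.ofHom θ)) ∧ IsClosed T₂ ∧ IsIrreducible T₂ ∧ j '' T₂ = S' ∧
        Scheme.IsRegular C.subscheme ∧ Flat (C.subschemeι ≫ σ' ≫ q) ∧ C.comap j = vanishingIdeal (⟨Z₂, hZ₂⟩ : Closeds F₂))
    -- THE MOVE
    (F₉ : Scheme.{0}) (β : F₉ ⟶ (Literature.AlgebraicGeometry.Motives.projectiveSpace 3 k).left) (T₉ E₉ : Set F₉) (hR : ReachEquinodalPlanarNose₂ k 3 ℓ T₁ F₉ β T₉ E₉) :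
    ∃ (X₉ : Scheme.{0}) (σ₉ : X₉ ⟶ P) (S₉ : Set X₉) (j₉ : F₉ ⟶ X₉) (t₉ : F₉ ⟶ Spec (.of k)),
      Ch X₉ σ₉ S₉ ∧ IsIntegral X₉ ∧ IsLocallyNoetherian X₉ ∧ Scheme.IsRegular X₉ ∧ IsDominant (σ₉ ≫ q) ∧
      IsPullback j₉ t₉ (σ₉ ≫ q) (Spec.map (CommRingCat.ofHom θ)) ∧ j₉ '' T₉ = S₉ ∧ IsClosed T₉ ∧ IsIrreducible T₉ ∧ IsIntegral F₉ ∧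
      TCPlus.LetterDatum O P q Y F₉ X₉ σ₉ j₉ E₉ := by
  classical
  obtain ⟨hE₉, Z, hZ, hZT, hTZ, hZinf, hZPi, hZirr, hZdim, hGreg, hEreg, hEdim, hcert, F₂, υ, T₂, E₂, Z₂, hZ₂, hmot, hZ₂T, hT₂Z, hZ₂inf,
    hZ₂dim, hZ₂reg, F₃, υ', hυ', γ', E', Es', Ns', K', htail, hβ⟩ := hR
  subst hE₉
  -- PHASE 1: the inner induction — ONE application of the door's universal motive clause to `RD`
  have hRD : RD F₂ υ T₂ E₂ Z₂ := hmot RD (JINIT Z hZ hZT hTZ hZinf hZPi hZirr hZdim hGreg hEreg hEdim hcert) HNODE HRDZ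
  -- PHASE 2: the reached upstairs stage and the GIVEN centre `C` (no (T-k) call here)
  obtain ⟨X', σ', S', j, t, C, hCh', hX'int, hX'noeth, hX'reg, hX'dom, hF₂, hsq, hT₂cl, hT₂irr, hjT₂, hCreg, hCfl, hCj⟩ :=
    HEND F₂ υ T₂ E₂ Z₂ hZ₂ hRD hZ₂T hZ₂reg
  subst hjT₂
  haveI := hPint; haveI := hPnoeth; haveI := hX'int; haveI := hX'noeth; haveI := hF₂
  -- E1-legality of `C` upstairs: off the generic point of `Y` (from the chain and `¬ T₂ ⊆ Z₂`)
  have hoff : σ' '' (C.support : Set X') ⊆ {y : P | ¬ IsGenericPoint y Y} :=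
    image_support_subset_not_isGenericPoint_of_chain θ hθ q Y hYsp σ' (j '' T₂) (hChSplit _ _ _ hCh') j t hsq T₂ rfl C Z₂ hZ₂ hCj hT₂Z
  have hCoff : ∀ c ∈ (C.support : Set X'), ¬ IsGenericPoint (σ' c) Y := fun c hc => hoff ⟨c, hc, rfl⟩
  -- the upstairs blow-up of `C` and the model square for the nose blow-up `υ'` (`modelStep_chain`)
  have hDT : (((vanishingIdeal (⟨Z₂, hZ₂⟩ : Closeds F₂)) : F₂.IdealSheafData).support : Set F₂) ⊆ T₂ := by
    rw [Scheme.IdealSheafData.coe_support_vanishingIdeal]; exact hZ₂T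
  have hTD : ¬ T₂ ⊆ (((vanishingIdeal (⟨Z₂, hZ₂⟩ : Closeds F₂)) : F₂.IdealSheafData).support : Set F₂) := by
    rw [Scheme.IdealSheafData.coe_support_vanishingIdeal]; exact hT₂Z
  obtain ⟨X₂, τ₂, hτ₂⟩ := exists_isBlowup X' C
  obtain ⟨hX₂i, hX₂n, hX₂r, hX₂dom, hF₃i, hirr₃, j₃, t₃, hsq₃, hcomm₃, hCh₃⟩ :=
    modelStep_chain O k θ hθ P q Y hYirr hYcl Ch hChSplit hChStep X' σ' (j '' T₂) hCh' hX'reg hX'dom F₂ j t hsq T₂ rfl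
      C (vanishingIdeal (⟨Z₂, hZ₂⟩ : Closeds F₂)) hCj hCreg hCfl hoff hDT hTD X₂ τ₂ hτ₂ F₃ υ' hυ'
  rw [Scheme.IdealSheafData.coe_support_vanishingIdeal] at hirr₃ hCh₃
  have hexc₃ : (C.comap τ₂).comap j₃ = (vanishingIdeal (⟨Z₂, hZ₂⟩ : Closeds F₂)).comap υ' := by
    rw [← Scheme.IdealSheafData.comap_comp, hcomm₃, Scheme.IdealSheafData.comap_comp, hCj]
  -- the stage-generic nose engine‴ on the B‴ tail, fed with (T-k) at the base `(k, O, θ, P, q)`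
  obtain ⟨X₉, σ₉, S₉, j₉, t₉, h1, h2, h3, h4, h5, h6, h7, h8, h9, h10⟩ :=
    hsub_reachNoseTowerBTriplePrime_of_fact' k O θ hθ P q Y Ch hChStep hChSplit hYsp hYirr hYcl hPint hPnoeth hPreg hqprop hqsm
      X' σ' (j '' T₂) hCh' hX'int hX'noeth hX'reg hX'dom F₂ hF₂ j t hsq T₂ hT₂cl hT₂irr rfl
      Z₂ hZ₂ hZ₂T hT₂Z hZ₂inf hZ₂dim C hCreg hCfl hCj hCoff X₂ τ₂ hτ₂ hX₂i hX₂n hX₂r hX₂dom F₃ hF₃i υ' hυ' j₃ t₃ hsq₃ hcomm₃ hexc₃ hirr₃ hCh₃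
      (hF k O θ hθ P q) F₉ γ' T₉ E' K' ⟨Es', Ns', htail⟩
  -- the host is dropped: `E₉ = ∅` has the trivial model
  exact ⟨X₉, σ₉, S₉, j₉, t₉, h1, h2, h3, h4, h5, h6, h7, h8, h9, h10, TCPlus.letterDatum_empty O P q Y F₉ X₉ σ₉ j₉⟩

end Summit.ResolutionOfSingularities.ResolutionOfSingularities.Cruxes.EquisingularLiftNat.Sections.Equinodal

end
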